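import Mathlib
import HarnessLib

/-!
# The bilinear Kakeya inequality in the plane (PROVED)

Analysis/Fourier support file for the `ℓ²`-decoupling programme (everything **proved**; no named
facts). We prove Theorem 10.21 of C. Demeter, *Fourier Restriction, Decoupling, and Applications*
(CUP 2020) — the planar (bilinear) case of the multilinear Kakeya inequality, which in two
dimensions is elementary geometry: two families `𝕋₁, 𝕋₂` of `2r × 2ℓ` rectangles ("tubes") whose
directions are `ν`-transverse (`|v_T ∧ v_{T'}| ≥ ν`) satisfy

  `∫ (∑_{T ∈ 𝕋₁} a_T 1_T)(∑_{T' ∈ 𝕋₂} a_{T'} 1_{T'}) ≤ ((2r)²/ν) (∑_T a_T)(∑_{T'} a_{T'})`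

(`lintegral_sum_indicator_mul_sum_indicator_le`), because two transverse slabs of width `2r` meet
in a parallelogram of area `(2r)²/|v ∧ v'|` (`volume_slab_inter_slab`). Normalising by
`|T| = 4 r ℓ` (`volume_tube`) this is `∫ g₁ g₂ ≤ (4 ν ℓ₁ ℓ₂)⁻¹ ∫ g₁ ∫ g₂`
(`lintegral_mul_le_of_tubes`), and with `r = R^{1/2}/2`, `ℓ = R/2` exactly Demeter's (10.14):
`∫ g₁ g₂ ≤ (ν R²)⁻¹ ∫ g₁ ∫ g₂` (`bilinearKakeya`). All functions are `ℝ≥0∞`-valued and the plane is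
`Fin 2 → ℝ` with Lebesgue measure.

## References

* C. Demeter, *Fourier Restriction, Decoupling, and Applications*, Cambridge Studies in Advanced
  Mathematics 184, Cambridge Univ. Press 2020 — Theorem 10.21 (and Chapter 6). [Demeter2019]
* J. Bourgain, C. Demeter, *A study guide for the l² decoupling theorem*, Chin. Ann. Math. Ser. B
  38 (2017) 173–200 = arXiv:1604.06032 — §8 (multilinear Kakeya, `n = 2`). [BourgainDemeter2016]
-/

noncomputable section

open MeasureTheory Real Set Finset
open scoped ENNReal Matrix

namespace Literature.Analysis.Fourier
namespace BilinearKakeya2D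

/-! ### Planar geometry: cross product, perpendicular, slabs, tubes -/

/-- The planar cross product `v ∧ w = v₀ w₁ - v₁ w₀`. [folklore] -/
def cross (v w : Fin 2 → ℝ) : ℝ := v 0 * w 1 - v 1 * w 0

/-- The rotation by `π/2`: `v^⊥ = (-v₁, v₀)`. [folklore] -/
def perp (v : Fin 2 → ℝ) : Fin 2 → ℝ := ![-(v 1), v 0]

/-- `perp v 0 = -v 1`. [folklore] -/
@[simp] theorem perp_zero (v : Fin 2 → ℝ) : perp v 0 = -(v 1) := rfl

/-- `perp v 1 = v 0`. [folklore] -/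
@[simp] theorem perp_one (v : Fin 2 → ℝ) : perp v 1 = v 0 := rfl

/-- `v^⊥ ∧ w^⊥ = v ∧ w`. [folklore] -/
theorem cross_perp_perp (v w : Fin 2 → ℝ) : cross (perp v) (perp w) = cross v w := by
  simp [cross]; ring

/-- `v^⊥ ∧ v = -(v₀² + v₁²)`. [folklore] -/
theorem cross_perp_self (v : Fin 2 → ℝ) : cross (perp v) v = -(v 0 ^ 2 + v 1 ^ 2) := by
  simp [cross]; ring

/-- The slab `{x : |w ⬝ x - s| ≤ r}` of normal `w`, level `s`, half-width `r` (in the `w ⬝ ·`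
coordinate). [folklore] -/
def slab (w : Fin 2 → ℝ) (s r : ℝ) : Set (Fin 2 → ℝ) := {x | |w ⬝ᵥ x - s| ≤ r}

/-- Membership in a slab. [folklore] -/
theorem mem_slab {w : Fin 2 → ℝ} {s r : ℝ} {x : Fin 2 → ℝ} : x ∈ slab w s r ↔ |w ⬝ᵥ x - s| ≤ r :=
  Iff.rfl

/-- Slabs are closed. [folklore] -/
theorem isClosed_slab (w : Fin 2 → ℝ) (s r : ℝ) : IsClosed (slab w s r) := by
  have : Continuous fun x : Fin 2 → ℝ => |w ⬝ᵥ x - s| := by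
    simp only [dotProduct, Fin.sum_univ_two]
    fun_prop
  exact isClosed_le this continuous_const

/-- Slabs are measurable. [folklore] -/
theorem measurableSet_slab (w : Fin 2 → ℝ) (s r : ℝ) : MeasurableSet (slab w s r) :=
  (isClosed_slab w s r).measurableSet

/-- The tube (rectangle) of centre `c`, direction `v`, half-width `r` across `v` and half-length
`ℓ` along `v`: `{x : |(x-c) ⬝ v^⊥| ≤ r, |(x-c) ⬝ v| ≤ ℓ}` (for a unit vector `v` this is a
`2ℓ × 2r` rectangle pointing in the direction `v`). [cite: Demeter2019, Theorem 10.21] -/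
def tube (c v : Fin 2 → ℝ) (r ℓ : ℝ) : Set (Fin 2 → ℝ) :=
  slab (perp v) (perp v ⬝ᵥ c) r ∩ slab v (v ⬝ᵥ c) ℓ

/-- Tubes are measurable. [folklore] -/
theorem measurableSet_tube (c v : Fin 2 → ℝ) (r ℓ : ℝ) : MeasurableSet (tube c v r ℓ) :=
  (measurableSet_slab _ _ _).inter (measurableSet_slab _ _ _)

/-- A tube lies in the slab across its direction. [folklore] -/
theorem tube_subset_slab (c v : Fin 2 → ℝ) (r ℓ : ℝ) : tube c v r ℓ ⊆ slab (perp v) (perp v ⬝ᵥ c) r :=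
  Set.inter_subset_left

/-! ### The linear map with two given rows, and areas -/

/-- The linear map `x ↦ (w₁ ⬝ x, w₂ ⬝ x)`. [folklore] -/
def rowsLin (w₁ w₂ : Fin 2 → ℝ) : (Fin 2 → ℝ) →ₗ[ℝ] (Fin 2 → ℝ) :=
  Matrix.toLin' !![w₁ 0, w₁ 1; w₂ 0, w₂ 1]

/-- First component. [folklore] -/
theorem rowsLin_apply_zero (w₁ w₂ x : Fin 2 → ℝ) : rowsLin w₁ w₂ x 0 = w₁ ⬝ᵥ x := by
  simp [rowsLin, Matrix.toLin'_apply, Matrix.mulVec, dotProduct, Fin.sum_univ_two]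

/-- Second component. [folklore] -/
theorem rowsLin_apply_one (w₁ w₂ x : Fin 2 → ℝ) : rowsLin w₁ w₂ x 1 = w₂ ⬝ᵥ x := by
  simp [rowsLin, Matrix.toLin'_apply, Matrix.mulVec, dotProduct, Fin.sum_univ_two]

/-- Its determinant is the cross product of the rows. [folklore] -/
theorem det_rowsLin (w₁ w₂ : Fin 2 → ℝ) : LinearMap.det (rowsLin w₁ w₂) = cross w₁ w₂ := by
  rw [rowsLin, LinearMap.det_toLin', Matrix.det_fin_two_of, cross]

/-- The intersection of two slabs is the preimage of a coordinate box under `rowsLin`. [folklore] -/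
theorem slab_inter_slab_eq_preimage (w₁ w₂ : Fin 2 → ℝ) (s₁ s₂ r₁ r₂ : ℝ) :
    slab w₁ s₁ r₁ ∩ slab w₂ s₂ r₂ =
      rowsLin w₁ w₂ ⁻¹' Set.Icc ![s₁ - r₁, s₂ - r₂] ![s₁ + r₁, s₂ + r₂] := by
  ext x
  simp only [Set.mem_inter_iff, mem_slab, Set.mem_preimage, Set.mem_Icc, Pi.le_def,
    Fin.forall_fin_two, rowsLin_apply_zero, rowsLin_apply_one, Matrix.cons_val_zero,
    Matrix.cons_val_one, abs_le]
  constructor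
  · rintro ⟨⟨h1, h2⟩, ⟨h3, h4⟩⟩; exact ⟨⟨by linarith, by linarith⟩, ⟨by linarith, by linarith⟩⟩
  · rintro ⟨⟨h1, h2⟩, ⟨h3, h4⟩⟩; exact ⟨⟨by linarith, by linarith⟩, ⟨by linarith, by linarith⟩⟩

/-- **Area of the intersection of two transverse slabs**:
`|slab₁ ∩ slab₂| = |w₁ ∧ w₂|⁻¹ · (2r₁)(2r₂)`. [folklore] -/
theorem volume_slab_inter_slab {w₁ w₂ : Fin 2 → ℝ} (h : cross w₁ w₂ ≠ 0) (s₁ s₂ r₁ r₂ : ℝ) :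
    volume (slab w₁ s₁ r₁ ∩ slab w₂ s₂ r₂) =
      ENNReal.ofReal |cross w₁ w₂|⁻¹ * (ENNReal.ofReal (2 * r₁) * ENNReal.ofReal (2 * r₂)) := by
  have hdet : LinearMap.det (rowsLin w₁ w₂) ≠ 0 := by rwa [det_rowsLin]
  rw [slab_inter_slab_eq_preimage, Measure.addHaar_preimage_linearMap volume hdet, det_rowsLin,
    Real.volume_Icc_pi, Fin.prod_univ_two]
  simp only [Matrix.cons_val_zero, Matrix.cons_val_one, abs_inv]
  congr 2 <;> ring_nf

/-- Hence, for `|w₁ ∧ w₂| ≥ ν > 0` and a common half-width `r`: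
`|slab₁ ∩ slab₂| ≤ (2r)²/ν`. [folklore] -/
theorem volume_slab_inter_slab_le {w₁ w₂ : Fin 2 → ℝ} {ν : ℝ} (hν : 0 < ν) (h : ν ≤ |cross w₁ w₂|)
    (s₁ s₂ r : ℝ) : volume (slab w₁ s₁ r ∩ slab w₂ s₂ r) ≤ ENNReal.ofReal ((2 * r) ^ 2 / ν) := by
  have hc : cross w₁ w₂ ≠ 0 := fun h0 => by rw [h0, abs_zero] at h; linarith
  rw [volume_slab_inter_slab hc]
  rcases le_or_gt 0 r with hr | hr
  · rw [← ENNReal.ofReal_mul (by positivity), ← ENNReal.ofReal_mul (by positivity)]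
    refine ENNReal.ofReal_le_ofReal ?_
    rw [div_eq_inv_mul, sq]
    refine mul_le_mul_of_nonneg_right ?_ (by positivity)
    exact inv_anti₀ hν h
  · have : ENNReal.ofReal (2 * r) = 0 := ENNReal.ofReal_of_nonpos (by linarith)
    simp [this]

/-- **Area of a tube**: for a unit vector `v`, `|tube c v r ℓ| = (2r)(2ℓ)`. [folklore] -/
theorem volume_tube {v : Fin 2 → ℝ} (hv : v 0 ^ 2 + v 1 ^ 2 = 1) (c : Fin 2 → ℝ) (r ℓ : ℝ) :
    volume (tube c v r ℓ) = ENNReal.ofReal (2 * r) * ENNReal.ofReal (2 * ℓ) := by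
  have hc : cross (perp v) v ≠ 0 := by rw [cross_perp_self, hv]; norm_num
  rw [tube, volume_slab_inter_slab hc, cross_perp_self, hv]
  norm_num

/-! ### The bilinear Kakeya inequality -/

/-- `∫ 1_T 1_{T'} = |T ∩ T'|` for measurable sets, as a product of indicators. [folklore] -/
theorem lintegral_indicator_one_mul_indicator_one {S T : Set (Fin 2 → ℝ)} (hS : MeasurableSet S)
    (hT : MeasurableSet T) :
    ∫⁻ x, S.indicator (1 : (Fin 2 → ℝ) → ℝ≥0∞) x * T.indicator 1 x = volume (S ∩ T) := by
  rw [← lintegral_indicator_one (hS.inter hT)]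
  refine lintegral_congr fun x => ?_
  rw [Set.inter_indicator_one, Pi.mul_apply]

/-- **Bilinear Kakeya, raw form.** For two finite families of tubes of common half-width `r`
whose directions are pairwise `ν`-transverse (`ν ≤ |v_T ∧ v_{T'}|`), and coefficients
`a_T, a_{T'} ∈ ℝ≥0∞`:
`∫ (∑_T a_T 1_T)(∑_{T'} a_{T'} 1_{T'}) ≤ ((2r)²/ν) (∑_T a_T)(∑_{T'} a_{T'})`.
[cite: Demeter2019, Theorem 10.21] -/
theorem lintegral_sum_indicator_mul_sum_indicator_le {τ₁ τ₂ : Type*} (T₁ : Finset τ₁)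
    (T₂ : Finset τ₂) (c₁ v₁ : τ₁ → Fin 2 → ℝ) (c₂ v₂ : τ₂ → Fin 2 → ℝ) (a₁ : τ₁ → ℝ≥0∞)
    (a₂ : τ₂ → ℝ≥0∞) (r ℓ₁ ℓ₂ : ℝ) {ν : ℝ} (hν : 0 < ν)
    (htrans : ∀ t ∈ T₁, ∀ t' ∈ T₂, ν ≤ |cross (v₁ t) (v₂ t')|) :
    ∫⁻ x, (∑ t ∈ T₁, a₁ t * (tube (c₁ t) (v₁ t) r ℓ₁).indicator 1 x) *
        (∑ t' ∈ T₂, a₂ t' * (tube (c₂ t') (v₂ t') r ℓ₂).indicator 1 x) ≤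
      ENNReal.ofReal ((2 * r) ^ 2 / ν) * (∑ t ∈ T₁, a₁ t) * (∑ t' ∈ T₂, a₂ t') := by
  -- expand the product of sums and integrate term by term
  have hmeas : ∀ (t : τ₁) (t' : τ₂), Measurable fun x =>
      a₁ t * (tube (c₁ t) (v₁ t) r ℓ₁).indicator 1 x * (a₂ t' * (tube (c₂ t') (v₂ t') r ℓ₂).indicator 1 x) := by
    intro t t'
    exact ((measurable_const.indicator (measurableSet_tube _ _ _ _)).const_mul _).mul
      ((measurable_const.indicator (measurableSet_tube _ _ _ _)).const_mul _)
  -- each term: `a a' |T ∩ T'| ≤ a a' (2r)²/ν`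
  have hterm : ∀ t ∈ T₁, ∀ t' ∈ T₂,
      ∫⁻ x, a₁ t * (tube (c₁ t) (v₁ t) r ℓ₁).indicator 1 x *
          (a₂ t' * (tube (c₂ t') (v₂ t') r ℓ₂).indicator 1 x) ≤
        ENNReal.ofReal ((2 * r) ^ 2 / ν) * a₁ t * a₂ t' := by
    intro t ht t' ht'
    have e : ∀ x, a₁ t * (tube (c₁ t) (v₁ t) r ℓ₁).indicator (1 : (Fin 2 → ℝ) → ℝ≥0∞) x *
        (a₂ t' * (tube (c₂ t') (v₂ t') r ℓ₂).indicator 1 x) =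
        a₁ t * a₂ t' * ((tube (c₁ t) (v₁ t) r ℓ₁).indicator 1 x *
          (tube (c₂ t') (v₂ t') r ℓ₂).indicator 1 x) := fun x => by ring
    simp_rw [e]
    have hprod : Measurable fun x => (tube (c₁ t) (v₁ t) r ℓ₁).indicator (1 : (Fin 2 → ℝ) → ℝ≥0∞) x *
        (tube (c₂ t') (v₂ t') r ℓ₂).indicator 1 x :=
      (measurable_const.indicator (measurableSet_tube _ _ _ _)).mul
        (measurable_const.indicator (measurableSet_tube _ _ _ _))
    rw [lintegral_const_mul _ hprod, lintegral_indicator_one_mul_indicator_one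
      (measurableSet_tube _ _ _ _) (measurableSet_tube _ _ _ _)]
    have hvol : volume (tube (c₁ t) (v₁ t) r ℓ₁ ∩ tube (c₂ t') (v₂ t') r ℓ₂) ≤
        ENNReal.ofReal ((2 * r) ^ 2 / ν) := by
      refine (measure_mono (Set.inter_subset_inter (tube_subset_slab _ _ _ _)
        (tube_subset_slab _ _ _ _))).trans ?_
      refine volume_slab_inter_slab_le hν ?_ _ _ r
      rw [cross_perp_perp]
      exact htrans t ht t' ht'
    calc a₁ t * a₂ t' * volume (tube (c₁ t) (v₁ t) r ℓ₁ ∩ tube (c₂ t') (v₂ t') r ℓ₂)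
        ≤ a₁ t * a₂ t' * ENNReal.ofReal ((2 * r) ^ 2 / ν) := mul_le_mul_right hvol _
      _ = ENNReal.ofReal ((2 * r) ^ 2 / ν) * a₁ t * a₂ t' := by ring
  calc ∫⁻ x, (∑ t ∈ T₁, a₁ t * (tube (c₁ t) (v₁ t) r ℓ₁).indicator 1 x) *
          (∑ t' ∈ T₂, a₂ t' * (tube (c₂ t') (v₂ t') r ℓ₂).indicator 1 x)
      = ∫⁻ x, ∑ t ∈ T₁, ∑ t' ∈ T₂, a₁ t * (tube (c₁ t) (v₁ t) r ℓ₁).indicator 1 x *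
          (a₂ t' * (tube (c₂ t') (v₂ t') r ℓ₂).indicator 1 x) :=
        lintegral_congr fun x => Finset.sum_mul_sum _ _ _ _
    _ = ∑ t ∈ T₁, ∑ t' ∈ T₂, ∫⁻ x, a₁ t * (tube (c₁ t) (v₁ t) r ℓ₁).indicator 1 x *
          (a₂ t' * (tube (c₂ t') (v₂ t') r ℓ₂).indicator 1 x) := by
        rw [lintegral_finsetSum _ fun t _ => Finset.measurable_sum _ fun t' _ => hmeas t t']
        exact Finset.sum_congr rfl fun t _ => lintegral_finsetSum _ fun t' _ => hmeas t t'
    _ ≤ ∑ t ∈ T₁, ∑ t' ∈ T₂, ENNReal.ofReal ((2 * r) ^ 2 / ν) * a₁ t * a₂ t' :=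
        Finset.sum_le_sum fun t ht => Finset.sum_le_sum fun t' ht' => hterm t ht t' ht'
    _ = ENNReal.ofReal ((2 * r) ^ 2 / ν) * (∑ t ∈ T₁, a₁ t) * (∑ t' ∈ T₂, a₂ t') := by
        have e2 : ∀ t, ∑ t' ∈ T₂, ENNReal.ofReal ((2 * r) ^ 2 / ν) * a₁ t * a₂ t' =
            ENNReal.ofReal ((2 * r) ^ 2 / ν) * a₁ t * ∑ t' ∈ T₂, a₂ t' := fun t => by
          rw [Finset.mul_sum]
        simp_rw [e2]
        rw [← Finset.sum_mul, ← Finset.mul_sum]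

/-- `∫ ∑_T a_T 1_T = (2r)(2ℓ) ∑_T a_T` for tubes with unit directions. [folklore] -/
theorem lintegral_sum_indicator_tube {τ : Type*} (T : Finset τ) (c v : τ → Fin 2 → ℝ)
    (hv : ∀ t ∈ T, v t 0 ^ 2 + v t 1 ^ 2 = 1) (a : τ → ℝ≥0∞) (r ℓ : ℝ) :
    ∫⁻ x, ∑ t ∈ T, a t * (tube (c t) (v t) r ℓ).indicator 1 x =
      ENNReal.ofReal (2 * r) * ENNReal.ofReal (2 * ℓ) * ∑ t ∈ T, a t := by
  have hmeas : ∀ t, Measurable fun x => a t * (tube (c t) (v t) r ℓ).indicator (1 : (Fin 2 → ℝ) → ℝ≥0∞) x :=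
    fun t => (measurable_const.indicator (measurableSet_tube _ _ _ _)).const_mul _
  rw [lintegral_finsetSum _ fun t _ => hmeas t, Finset.mul_sum]
  refine Finset.sum_congr rfl fun t ht => ?_
  have h1 : Measurable ((tube (c t) (v t) r ℓ).indicator (1 : (Fin 2 → ℝ) → ℝ≥0∞)) :=
    measurable_one.indicator (measurableSet_tube _ _ _ _)
  rw [lintegral_const_mul _ h1, lintegral_indicator_one (measurableSet_tube _ _ _ _),
    volume_tube (hv t ht)]
  ring

/-- **Bilinear Kakeya for tubes (normalised form).** Two finite families of `2r × 2ℓᵢ` tubes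
(`r, ℓ₁, ℓ₂ > 0`, unit directions) with pairwise `ν`-transverse directions satisfy
`∫ g₁ g₂ ≤ (4 ν ℓ₁ ℓ₂)⁻¹ (∫ g₁)(∫ g₂)` for `gᵢ = ∑_{T ∈ 𝕋ᵢ} a_T 1_T`, `a_T ∈ ℝ≥0∞`.
[cite: Demeter2019, Theorem 10.21] -/
theorem lintegral_mul_le_of_tubes {τ₁ τ₂ : Type*} (T₁ : Finset τ₁) (T₂ : Finset τ₂)
    (c₁ v₁ : τ₁ → Fin 2 → ℝ) (c₂ v₂ : τ₂ → Fin 2 → ℝ) (hv₁ : ∀ t ∈ T₁, v₁ t 0 ^ 2 + v₁ t 1 ^ 2 = 1)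
    (hv₂ : ∀ t ∈ T₂, v₂ t 0 ^ 2 + v₂ t 1 ^ 2 = 1) (a₁ : τ₁ → ℝ≥0∞) (a₂ : τ₂ → ℝ≥0∞)
    {r ℓ₁ ℓ₂ ν : ℝ} (hr : 0 < r) (hℓ₁ : 0 < ℓ₁) (hℓ₂ : 0 < ℓ₂) (hν : 0 < ν)
    (htrans : ∀ t ∈ T₁, ∀ t' ∈ T₂, ν ≤ |cross (v₁ t) (v₂ t')|) :
    ∫⁻ x, (∑ t ∈ T₁, a₁ t * (tube (c₁ t) (v₁ t) r ℓ₁).indicator 1 x) *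
        (∑ t' ∈ T₂, a₂ t' * (tube (c₂ t') (v₂ t') r ℓ₂).indicator 1 x) ≤
      ENNReal.ofReal (4 * ν * ℓ₁ * ℓ₂)⁻¹ *
        (∫⁻ x, ∑ t ∈ T₁, a₁ t * (tube (c₁ t) (v₁ t) r ℓ₁).indicator 1 x) *
        (∫⁻ x, ∑ t' ∈ T₂, a₂ t' * (tube (c₂ t') (v₂ t') r ℓ₂).indicator 1 x) := by
  rw [lintegral_sum_indicator_tube T₁ c₁ v₁ hv₁ a₁ r ℓ₁,
    lintegral_sum_indicator_tube T₂ c₂ v₂ hv₂ a₂ r ℓ₂]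
  refine (lintegral_sum_indicator_mul_sum_indicator_le T₁ T₂ c₁ v₁ c₂ v₂ a₁ a₂ r ℓ₁ ℓ₂ hν
    htrans).trans (le_of_eq ?_)
  -- constants: `(2r)²/ν = (4νℓ₁ℓ₂)⁻¹ (2r)(2ℓ₁)(2r)(2ℓ₂)`
  have e : ENNReal.ofReal ((2 * r) ^ 2 / ν) = ENNReal.ofReal (4 * ν * ℓ₁ * ℓ₂)⁻¹ *
      (ENNReal.ofReal (2 * r) * ENNReal.ofReal (2 * ℓ₁)) *
      (ENNReal.ofReal (2 * r) * ENNReal.ofReal (2 * ℓ₂)) := by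
    rw [← ENNReal.ofReal_mul (by positivity), ← ENNReal.ofReal_mul (by positivity),
      ← ENNReal.ofReal_mul (by positivity), ← ENNReal.ofReal_mul (by positivity)]
    congr 1
    field_simp
    ring
  rw [e]
  ring

/-- **Bilinear Kakeya inequality (Demeter's Theorem 10.21, (10.14)).** Let `𝕋₁, 𝕋₂` be finite
families of rectangles with short side `R^{1/2}` and long side `R` pointing in unit directions
`v_T` (`tube c_T v_T (R^{1/2}/2) (R/2)`), with `|v_{T} ∧ v_{T'}| ≥ ν > 0` for `T ∈ 𝕋₁`,
`T' ∈ 𝕋₂`. Then for `gᵢ = ∑_{T ∈ 𝕋ᵢ} a_T 1_T` (`a_T ∈ [0, ∞]`):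
`∫ g₁ g₂ ≤ (ν R²)⁻¹ ∫ g₁ ∫ g₂`; the constant depends only on the transversality `ν`.
[cite: Demeter2019, Theorem 10.21] -/
theorem bilinearKakeya {τ₁ τ₂ : Type*} (T₁ : Finset τ₁) (T₂ : Finset τ₂)
    (c₁ v₁ : τ₁ → Fin 2 → ℝ) (c₂ v₂ : τ₂ → Fin 2 → ℝ) (hv₁ : ∀ t ∈ T₁, v₁ t 0 ^ 2 + v₁ t 1 ^ 2 = 1)
    (hv₂ : ∀ t ∈ T₂, v₂ t 0 ^ 2 + v₂ t 1 ^ 2 = 1) (a₁ : τ₁ → ℝ≥0∞) (a₂ : τ₂ → ℝ≥0∞)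
    {R ν : ℝ} (hR : 0 < R) (hν : 0 < ν)
    (htrans : ∀ t ∈ T₁, ∀ t' ∈ T₂, ν ≤ |cross (v₁ t) (v₂ t')|) :
    ∫⁻ x, (∑ t ∈ T₁, a₁ t * (tube (c₁ t) (v₁ t) (√R / 2) (R / 2)).indicator 1 x) *
        (∑ t' ∈ T₂, a₂ t' * (tube (c₂ t') (v₂ t') (√R / 2) (R / 2)).indicator 1 x) ≤
      ENNReal.ofReal (ν * R ^ 2)⁻¹ *
        (∫⁻ x, ∑ t ∈ T₁, a₁ t * (tube (c₁ t) (v₁ t) (√R / 2) (R / 2)).indicator 1 x) *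
        (∫⁻ x, ∑ t' ∈ T₂, a₂ t' * (tube (c₂ t') (v₂ t') (√R / 2) (R / 2)).indicator 1 x) := by
  have h := lintegral_mul_le_of_tubes T₁ T₂ c₁ v₁ c₂ v₂ hv₁ hv₂ a₁ a₂ (r := √R / 2)
    (by positivity) (by positivity : 0 < R / 2) (by positivity : 0 < R / 2) hν htrans
  have e : (4 * ν * (R / 2) * (R / 2))⁻¹ = (ν * R ^ 2)⁻¹ := by congr 1; ring
  rwa [e] at h

end BilinearKakeya2D
end Literature.Analysis.Fourier
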